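import Summits.BirchSwinnertonDyer.BirchSwinnertonDyer.Theses.NormCapitulation

/-!
# `UniversalNorm` (crux `stmt-BirchSwinnertonDyer-17968`): the bottom layer forces `c ≥ 1` and a
# point of infinite order in `E(K)`

Tightness / degenerate-layer certificate for the crux `UniversalNorm` of route `NormCapitulation`
(refuter crux-attack at birth, `--supports stmt-BirchSwinnertonDyer-17968`).  The crux asks, for a
Heegner field `K` and an anticyclotomic `ℤ_p`-extension `κ`, for an exponent `c : ℕ` such that EVERY
layer `K_n` carries a point `P ∈ E(K̄)^{κ⁻¹(pⁿℤ_p)} = E(K_n)` whose norm `∑_{a ∈ ℤ/pⁿ} σ_a • P` is not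
of the form `p^c • Q + torsion` with `Q ∈ E(K̄)^{Γ_K} = E(K)`.

* `layerClause_exponent_pos`: at the layer `n = 0` one has `κ⁻¹(p⁰ℤ_p) = Γ_K`
  (`ZpExtension.layerSubgroup_zero`), so `P` is itself `Γ_K`-fixed, the sum over `ZMod (p^0) = ZMod 1`
  is the single term `σ_0 • P = P`, and `Q := P` gives `P - p^0 • P = 0`; hence the clause with
  `c = 0` is unsatisfiable for every `(V, K, p, κ)` and any witness of the crux has `1 ≤ c`.
  (The natural strengthening "`c = 0`", i.e. norms outside `E(K) + torsion`, is trivially false; the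
  `p^c`-saturation in the statement is load-bearing exactly as the informal text says — p-adic, not
  integral, universal norms.)
* `exists_fixed_of_layerClause`: the same layer `n = 0` shows that the clause already contains the
  Mordell–Weil statement "`E(K)` has a `Γ_K`-fixed point outside `p^c • E(K) + torsion`", in
  particular a `K`-rational point of infinite order (the route text's "UN contains rank `E(K) ≥ 1`").

Both are bookkeeping over the tree API of `Literature.NumberTheory.EllipticCurves.ZpExtension`; no
arithmetic input. [folklore]
-/

noncomputable section

set_option linter.dupNamespace false

namespace Summit.BirchSwinnertonDyer.BirchSwinnertonDyer.Theorems.UniversalNorm.Negative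

open Literature.NumberTheory.EllipticCurves

variable (V : WeierstrassCurve ℚ) (K : Type) [Field K] [NumberField K] (p : ℕ) [Fact p.Prime]
  (κ : ZpExtension K p) (c : ℕ)

/-- **The exponent of a universal-norm witness is positive.**  If `c` witnesses the layer clause of
`UniversalNorm` for `(V, K, p, κ)` (verbatim the clause after `∃ c : ℕ` in the crux), then `1 ≤ c`:
at `n = 0` the point `P` is `Γ_K`-fixed (`layerSubgroup_zero`), its "norm" over `ZMod (p^0)` is `P`,
and `Q := P`, `m := 1` violate the clause when `c = 0`. [folklore] -/
theorem layerClause_exponent_pos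
    (h : ∀ n : ℕ, ∃ P : (V.baseChange K).geomPoints, (∀ τ ∈ κ.layerSubgroup n, τ • P = P) ∧
      ∃ σ : ZMod (p ^ n) → Field.absoluteGaloisGroup K,
        (∀ a : ZMod (p ^ n), PadicInt.toZModPow n (Multiplicative.toAdd (κ (σ a))) = a) ∧
        ∀ Q : (V.baseChange K).geomPoints, (∀ g : Field.absoluteGaloisGroup K, g • Q = Q) →
          ∀ m : ℕ, 0 < m → m • ((∑ a : ZMod (p ^ n), σ a • P) - p ^ c • Q) ≠ 0) :
    1 ≤ c := by
  rcases c with _ | c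
  · exfalso
    obtain ⟨P, hP, σ, -, hQ⟩ := h 0
    have hfix : ∀ g : Field.absoluteGaloisGroup K, g • P = P := fun g =>
      hP g (by rw [ZpExtension.layerSubgroup_zero]; exact Subgroup.mem_top g)
    haveI : Subsingleton (ZMod (p ^ 0)) := ZMod.subsingleton_iff.mpr (pow_zero p)
    refine hQ P hfix 1 one_pos ?_
    rw [one_smul, Fintype.sum_subsingleton (fun a => σ a • P) (0 : ZMod (p ^ 0)), hfix, pow_zero,
      one_smul, sub_self]
  · exact Nat.succ_pos c

/-- **The bottom layer is a Mordell–Weil statement.**  The layer clause of `UniversalNorm` for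
`(V, K, p, κ, c)` yields a `Γ_K`-fixed geometric point `P` (a point of `E(K)`, by Galois descent)
such that `P - p^c • Q` is of infinite order for every `Γ_K`-fixed `Q`; with `Q := 0`, `P` itself has
infinite order.  (Layer `n = 0`: `κ⁻¹(p⁰ℤ_p) = Γ_K` and the norm sum is `P`.) [folklore] -/
theorem exists_fixed_of_layerClause
    (h : ∀ n : ℕ, ∃ P : (V.baseChange K).geomPoints, (∀ τ ∈ κ.layerSubgroup n, τ • P = P) ∧
      ∃ σ : ZMod (p ^ n) → Field.absoluteGaloisGroup K,
        (∀ a : ZMod (p ^ n), PadicInt.toZModPow n (Multiplicative.toAdd (κ (σ a))) = a) ∧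
        ∀ Q : (V.baseChange K).geomPoints, (∀ g : Field.absoluteGaloisGroup K, g • Q = Q) →
          ∀ m : ℕ, 0 < m → m • ((∑ a : ZMod (p ^ n), σ a • P) - p ^ c • Q) ≠ 0) :
    ∃ P : (V.baseChange K).geomPoints, (∀ g : Field.absoluteGaloisGroup K, g • P = P) ∧
      (∀ Q : (V.baseChange K).geomPoints, (∀ g : Field.absoluteGaloisGroup K, g • Q = Q) →
        ∀ m : ℕ, 0 < m → m • (P - p ^ c • Q) ≠ 0) ∧
      ∀ m : ℕ, 0 < m → m • P ≠ 0 := by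
  obtain ⟨P, hP, σ, -, hQ⟩ := h 0
  have hfix : ∀ g : Field.absoluteGaloisGroup K, g • P = P := fun g =>
    hP g (by rw [ZpExtension.layerSubgroup_zero]; exact Subgroup.mem_top g)
  haveI : Subsingleton (ZMod (p ^ 0)) := ZMod.subsingleton_iff.mpr (pow_zero p)
  have hsum : (∑ a : ZMod (p ^ 0), σ a • P) = P := by
    rw [Fintype.sum_subsingleton (fun a => σ a • P) (0 : ZMod (p ^ 0)), hfix]
  refine ⟨P, hfix, fun Q hQfix m hm => ?_, fun m hm => ?_⟩
  · simpa only [hsum] using hQ Q hQfix m hm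
  · simpa only [hsum, smul_zero, sub_zero] using hQ 0 (fun g => smul_zero g) m hm

end Summit.BirchSwinnertonDyer.BirchSwinnertonDyer.Theorems.UniversalNorm.Negative

end
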